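import Mathlib.Topology.PartitionOfUnity
import Mathlib.MeasureTheory.Measure.WithDensity
import Mathlib.MeasureTheory.Measure.OpenPos
import Mathlib.MeasureTheory.Integral.Bochner.ContinuousLinearMap
import Mathlib.MeasureTheory.Constructions.BorelSpace.Basic

/-!
# PUSH-FORWARD DENSITIES: CONTINUITY IS LOCAL ON THE SOURCE — the partition-of-unity GLUING of per-point
# «Jacobian faces» into ONE density continuous on the WHOLE target ([HormanderALPDO1] §6.1, proof of Thm 6.1.2:
# «… by a partition of unity»; [EvansGariepy1992] §3.4.3)

Generic topology ∕ measure theory; every declaration is a THEOREM proved here from Mathlib (no `def`, no named fact, no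
`sorry`).  LOCATED CONSUMER (cell `pub-ymgap`, YM-PLAN Track A, node N09 [B12] width seat `pub-ymgap-dag-n09-w2` g4,
`--supports` K1⁷ `StabilityBAtRecordR13SepCoPH` = stmt-QuantumFields-20542, count-neutral helper): node00-def-K0e's located
debt (F1) «the Jacobian face of [Balaban1987RG1] (0.4)'s disintegration» (`P7-LOCATOR-AUDIT.md` §4, `F1-PROGRAMME-DESIGN.md`
M3∕M4).  The sibling files of this directory give the LOCAL engines: `SubmersionPushforwardDensity` (p610570: near ONE regular point
`a` of a `C¹` submersion `M`, every density supported in a source window `O ∋ a` has a push-forward density continuous on a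
target window `D ∋ M a`) and `AnalyticSubmersionSharpDensity` (p613264: the same for densities continuous only off an analytic
transverse threshold).  At the record the fibres `Ū⁻¹(V)` of the block averaging are whole compact submanifolds of `SU(N)^{B_f}`
— no single window contains them — while the wanted conclusion (`hreg : domAlt ⊆ regSetOfRecord …`, a version of the transform
continuous on an OPEN set of coarse fields) is about ALL the mass above that set.  THIS FILE is the missing generic step:
**a source-side partition of unity over the compact support glues the per-point statements into ONE density, continuous on
the whole target.**

WHAT IS PROVED (namespace `Literature.MeasureTheory.Integral.PushforwardDensityGluing`).
* §1 `eqOn_zero_of_setLIntegral_eq_zero` — a non-negative function continuous on an open set `U` with `∫⁻_U I dμ = 0`, `μ`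
  positive on non-empty open sets, vanishes on `U`.
* §2 ★★★ **`exists_continuous_density_of_locally'`** (sharp form) ∕ **`exists_continuous_density_of_locally`** (engine
  form) — SETTING: `X` locally compact T₂ (source), `Y` regular (target), any measure `ν` on `X`, an open-positive measure `μ`
  on `Y`, `M : X → Y` measurable, a pointwise exemption predicate `Q : X → Prop` (`Q ≡ True` for the `C¹` engine,
  `Q x := g x ≠ 0` for the sharp one), a compact `K ⊆ X`.  HYPOTHESIS, per point `a ∈ K`: `M` is continuous at `a` and there
  are open `O ∋ a`, `D ∋ M a` such that EVERY measurable bounded `r′ ≥ 0` vanishing off `O` and continuous at each `x ∈ O`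
  with `Q x` (engine form — verbatim the conclusion shape of the two local engines; the sharp form asks the face only of the
  `r′` continuous at every point of `X` off the exempt part of the window, so that windows can be cut down) has above `D` a
  density of `M_*(r′·ν)` w.r.t. `μ` continuous on `D`.  CONCLUSION: every measurable bounded `r ≥ 0` vanishing off `K` and
  continuous at each `x ∈ K` with `Q x` has `I ≥ 0`, CONTINUOUS ON ALL OF `Y`, with `(r·ν)(M⁻¹A) = ∫⁻_A I dμ` for every
  measurable `A`.  Proof: shrink each target window (`cl D′_a ⊆ D_a`, regularity), refine the source windows to
  `O_a ∩ int M⁻¹D′_a`, take a finite subcover of `K` and a subordinate partition of unity `φ_i` (Mathlib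
  `PartitionOfUnity.exists_isSubordinate_of_locallyFinite_t2space`), apply the hypothesis to `φ_i·r`, observe by §1 that the
  local density vanishes on `D_i ∖ cl D′_i`, extend it by zero off `D_i` (continuous!), and sum.
  `exists_continuous_density_of_locally_of_compactSpace` — compact source, `K = univ`.
* §3 FORMS FOR CONSUMERS (pure bookkeeping): `map_withDensity_eq_withDensity_of_forall_preimage` (set identity ⇒
  `(ρ·ν).map M = I·μ`), `restrict_map_withDensity_eq_of_forall_preimage` (the window version), `lintegral_comp_mul_eq_of_forall_preimage`,
  ★ `integral_mul_comp_eq_integral_mul_of_forall_preimage` — the test-function identity `∫ r x * f (M x) dν = ∫ I W * f W dμ` for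
  every measurable real `f` (no integrability needed: both Bochner integrals are junk together), i.e. EXACTLY the hypothesis `h` of
  `Node00.RegSetOfFibredChart.subset_regSetOfRecord_of_forall_integral_eq` ∕ `hasContTransportOn_of_forall_integral_eq` — and
  `integral_mul_comp_eq_integral_mul_of_forall_preimage_subset` (window version, tests vanishing off the window).

HONEST SCOPE.  (i) Nothing model-specific: no chart, no change of variables, no claim about Bałaban's averaging (whose per-point
submersion property through the group chart, the transversality of the thresholds and N07's continuity input are the consumer's
located inputs), about N09, or about the Clay problem.  (ii) The hypothesis is required at EVERY point of `K`; where `M` is not a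
submersion the density must vanish.  (iii) The value of the glued density is partition-dependent bookkeeping; its existence and
continuity are not (and by §1-type determinacy it is unique on the target wherever `μ` sees every open set).
-/

noncomputable section

namespace Literature.MeasureTheory.Integral.PushforwardDensityGluing

open _root_.MeasureTheory _root_.MeasureTheory.Measure Set Function Filter
open scoped ENNReal NNReal Topology

/-! ## §1 A non-negative continuous function with zero integral on an open set vanishes there -/

section Vanishing

variable {Y : Type*} [TopologicalSpace Y] [MeasurableSpace Y] [OpensMeasurableSpace Y]

/-- **Determinacy of continuous densities.**  If `μ` is positive on non-empty open sets, `U` is open, `I ≥ 0` is continuous on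
`U` and `∫⁻_U I dμ = 0`, then `I = 0` on `U` (otherwise `I > I(y)/2` on a non-empty open subset of positive measure) —
the positivity variant of «a continuous function is determined by its integrals against tests».
[cite: HormanderALPDO1, Thm 1.2.4 (positivity variant)] -/
theorem eqOn_zero_of_setLIntegral_eq_zero (μ : Measure Y) [μ.IsOpenPosMeasure] {U : Set Y} (hU : IsOpen U)
    {I : Y → ℝ} (hI : ContinuousOn I U) (hI0 : ∀ y ∈ U, 0 ≤ I y)
    (h : ∫⁻ y in U, ENNReal.ofReal (I y) ∂μ = 0) : ∀ y ∈ U, I y = 0 := by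
  by_contra hne
  push Not at hne
  obtain ⟨y, hyU, hy⟩ := hne
  have hpos : 0 < I y := lt_of_le_of_ne (hI0 y hyU) (Ne.symm hy)
  have hVo : IsOpen (U ∩ I ⁻¹' Ioi (I y / 2)) := hI.isOpen_inter_preimage hU isOpen_Ioi
  have hyV : y ∈ U ∩ I ⁻¹' Ioi (I y / 2) := ⟨hyU, by simpa using half_lt_self hpos⟩
  have hμV : 0 < μ (U ∩ I ⁻¹' Ioi (I y / 2)) := hVo.measure_pos μ ⟨y, hyV⟩
  have hle : ENNReal.ofReal (I y / 2) * μ (U ∩ I ⁻¹' Ioi (I y / 2)) ≤ ∫⁻ z in U, ENNReal.ofReal (I z) ∂μ :=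
    calc ENNReal.ofReal (I y / 2) * μ (U ∩ I ⁻¹' Ioi (I y / 2))
        = ∫⁻ _ in U ∩ I ⁻¹' Ioi (I y / 2), ENNReal.ofReal (I y / 2) ∂μ := (setLIntegral_const _ _).symm
      _ ≤ ∫⁻ z in U ∩ I ⁻¹' Ioi (I y / 2), ENNReal.ofReal (I z) ∂μ :=
          setLIntegral_mono' hVo.measurableSet fun z hz => ENNReal.ofReal_le_ofReal (le_of_lt (mem_Ioi.1 hz.2))
      _ ≤ ∫⁻ z in U, ENNReal.ofReal (I z) ∂μ := lintegral_mono_set inter_subset_left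
  rw [h] at hle
  have h0 : ENNReal.ofReal (I y / 2) * μ (U ∩ I ⁻¹' Ioi (I y / 2)) = 0 := le_antisymm hle bot_le
  rcases mul_eq_zero.1 h0 with h1 | h2
  · rw [ENNReal.ofReal_eq_zero] at h1
    exact absurd h1 (not_le.2 (half_pos hpos))
  · exact absurd h2 hμV.ne'

end Vanishing

/-! ## §2 The gluing theorem -/

section Gluing

variable {X : Type*} [TopologicalSpace X] [T2Space X] [LocallyCompactSpace X] [MeasurableSpace X]
  [OpensMeasurableSpace X]
  {Y : Type*} [TopologicalSpace Y] [RegularSpace Y] [MeasurableSpace Y] [OpensMeasurableSpace Y]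

/-- ★★★ **PUSH-FORWARD DENSITIES: CONTINUITY IS LOCAL ON THE SOURCE (partition-of-unity gluing), sharp form.**
`X` locally compact T₂, `Y` regular, `ν` any measure on `X`, `μ` a measure on `Y` positive on non-empty open sets, `M : X → Y`
measurable, `Q : X → Prop` an exemption predicate, `K ⊆ X` compact.  Suppose that at every `a ∈ K` the map `M` is continuous and
there are open windows `O ∋ a`, `D ∋ M a` carrying the LOCAL JACOBIAN FACE in its weakest useful form: every measurable bounded
`r′ ≥ 0` vanishing off `O` and continuous at EVERY point `x` of `X` except possibly the exempt points of the window (`x ∈ O`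
with `¬ Q x`) admits `I′ ≥ 0` continuous on `D` with `(r′·ν)(M⁻¹A) = ∫⁻_A I′ dμ` for all measurable `A ⊆ D`.  (This is implied
by the one-window conclusion shape of `SubmersionPushforward.exists_continuousOn_density_map_of_submersion` (`Q ≡ True`) and
of `AnalyticSubmersion.exists_continuousOn_density_map_of_analytic_submersion_sharp` (`Q x := g x ≠ 0`), which ask continuity
only inside `O` — see `exists_continuous_density_of_locally`; asking it everywhere off the exempt set lets windows be CUT DOWN
(`O ∩ {Q}`, chart domains) without losing the face, which the one-window form does not.)  THEN every measurable bounded `r ≥ 0`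
vanishing off `K` and continuous at each `x ∈ K` with `Q x` has a push-forward density `I ≥ 0` that is CONTINUOUS ON ALL OF
`Y`: `(r·ν)(M⁻¹A) = ∫⁻_A I dμ` for every measurable `A`.  Proof: regular shrink `cl D″_a ⊆ D_a` of the target windows, refined
source windows `O_a ∩ int M⁻¹D″_a`, a finite subcover of `K`, a subordinate partition of unity `φ_i`
(`PartitionOfUnity.exists_isSubordinate_of_locallyFinite_t2space`), the hypothesis applied to `φ_i·r` (continuous wherever `r`
is or `φ_i` vanishes nearby), §1 (the local density vanishes on `D_i ∖ cl D″_i`), extension by zero off `D_i`, a finite sum.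
[cite: HormanderALPDO1, §6.1, proof of Thm 6.1.2 (push-forward under a submersion, «by a partition of unity»)] -/
theorem exists_continuous_density_of_locally' (ν : Measure X) (μ : Measure Y) [μ.IsOpenPosMeasure]
    {M : X → Y} (hM : Measurable M) (Q : X → Prop) {K : Set X} (hK : IsCompact K)
    (hloc : ∀ a ∈ K, ∃ O : Set X, ∃ D : Set Y, ContinuousAt M a ∧ IsOpen O ∧ a ∈ O ∧ IsOpen D ∧ M a ∈ D ∧
      ∀ r : X → ℝ, Measurable r → (∀ x, 0 ≤ r x) → (∀ x, (x ∈ O → Q x) → ContinuousAt r x) →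
        (∃ C : ℝ, ∀ x, r x ≤ C) → (∀ x, x ∉ O → r x = 0) →
        ∃ I : Y → ℝ, ContinuousOn I D ∧ (∀ W, 0 ≤ I W) ∧ ∀ A : Set Y, MeasurableSet A → A ⊆ D →
          (ν.withDensity fun x => ENNReal.ofReal (r x)) (M ⁻¹' A) = ∫⁻ W in A, ENNReal.ofReal (I W) ∂μ)
    (r : X → ℝ) (hrm : Measurable r) (hr0 : ∀ x, 0 ≤ r x) (hrc : ∀ x ∈ K, Q x → ContinuousAt r x)
    (hrC : ∃ C : ℝ, ∀ x, r x ≤ C) (hrK : ∀ x, x ∉ K → r x = 0) :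
    ∃ I : Y → ℝ, Continuous I ∧ (∀ W, 0 ≤ I W) ∧ ∀ A : Set Y, MeasurableSet A →
      (ν.withDensity fun x => ENNReal.ofReal (r x)) (M ⁻¹' A) = ∫⁻ W in A, ENNReal.ofReal (I W) ∂μ := by
  classical
  -- per-point data
  choose! O D hMc hO haO hD haD hH using hloc
  -- shrink the target windows: `M a ∈ D' a`, `closure (D' a) ⊆ D a`
  have hD'ex : ∀ a ∈ K, ∃ D' : Set Y, IsOpen D' ∧ M a ∈ D' ∧ closure D' ⊆ D a := by
    intro a ha
    obtain ⟨t, ht, htc, htD⟩ := exists_mem_nhds_isClosed_subset ((hD a ha).mem_nhds (haD a ha))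
    exact ⟨interior t, isOpen_interior, mem_interior_iff_mem_nhds.2 ht,
      (closure_minimal interior_subset htc).trans htD⟩
  choose! D' hD'o haD' hD'c using hD'ex
  have hD'D : ∀ a ∈ K, D' a ⊆ D a := fun a ha => subset_closure.trans (hD'c a ha)
  -- refine the source windows: `O a ∩ interior (M ⁻¹' D' a)`
  have hWo : ∀ a ∈ K, IsOpen (O a ∩ interior (M ⁻¹' D' a)) := fun a ha => (hO a ha).inter isOpen_interior
  have haW : ∀ a ∈ K, a ∈ O a ∩ interior (M ⁻¹' D' a) := fun a ha =>
    ⟨haO a ha, mem_interior_iff_mem_nhds.2 ((hMc a ha).preimage_mem_nhds ((hD'o a ha).mem_nhds (haD' a ha)))⟩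
  -- a finite subcover of `K`
  obtain ⟨t, htK, ht⟩ : ∃ t : Finset X, (∀ a ∈ t, a ∈ K) ∧ K ⊆ ⋃ a ∈ t, O a ∩ interior (M ⁻¹' D' a) :=
    hK.elim_nhds_subcover (fun a => O a ∩ interior (M ⁻¹' D' a)) fun a ha => (hWo a ha).mem_nhds (haW a ha)
  -- a partition of unity on `K` subordinate to the refined windows, indexed by `t`
  obtain ⟨φ, hφ, -⟩ := PartitionOfUnity.exists_isSubordinate_of_locallyFinite_t2space hK
    (fun i : t => O (i : X) ∩ interior (M ⁻¹' D' (i : X))) (fun i => hWo _ (htK _ i.2))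
    (locallyFinite_of_finite _) (fun x hx => by
      obtain ⟨a, hat, hxa⟩ := mem_iUnion₂.1 (ht hx)
      exact mem_iUnion.2 ⟨⟨a, hat⟩, hxa⟩)
  have htK' : ∀ i : t, (i : X) ∈ K := fun i => htK _ i.2
  have hφW : ∀ i : t, ∀ x, φ i x ≠ 0 → x ∈ O (i : X) ∩ interior (M ⁻¹' D' (i : X)) :=
    fun i x hx => hφ i (subset_tsupport _ (Function.mem_support.2 hx))
  have hφD' : ∀ i : t, ∀ x, φ i x ≠ 0 → M x ∈ D' (i : X) := fun i x hx => by
    have hx' : x ∈ M ⁻¹' D' (i : X) := interior_subset (hφW i x hx).2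
    exact hx'
  -- the pieces `φ i · r`
  obtain ⟨C, hC⟩ := hrC
  have hmeas : ∀ i : t, Measurable fun x => φ i x * r x := fun i => (φ i).continuous.measurable.mul hrm
  have hnn : ∀ i : t, ∀ x, 0 ≤ φ i x * r x := fun i x => mul_nonneg (φ.nonneg i x) (hr0 x)
  have hle_r : ∀ i : t, ∀ x, φ i x * r x ≤ r x := fun i x => mul_le_of_le_one_left (hr0 x) (φ.le_one i x)
  have hbdd : ∀ i : t, ∃ C : ℝ, ∀ x, φ i x * r x ≤ C := fun i => ⟨C, fun x => (hle_r i x).trans (hC x)⟩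
  have hzero : ∀ i : t, ∀ x, x ∉ O (i : X) → φ i x * r x = 0 := by
    intro i x hx
    have : φ i x = 0 := by
      by_contra h
      exact hx (hφW i x h).1
    simp [this]
  have hcont : ∀ i : t, ∀ x, (x ∈ O (i : X) → Q x) → ContinuousAt (fun x => φ i x * r x) x := by
    intro i x hQ
    by_cases hxs : x ∈ tsupport (φ i)
    · have hxO' : x ∈ O (i : X) := (hφ i hxs).1
      by_cases hxK : x ∈ K
      · exact (φ i).continuous.continuousAt.mul (hrc x hxK (hQ hxO'))
      · have hev : (fun x => φ i x * r x) =ᶠ[𝓝 x] fun _ => (0 : ℝ) := by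
          filter_upwards [hK.isClosed.isOpen_compl.mem_nhds hxK] with z hz
          simp [hrK z hz]
        exact (continuousAt_congr hev).2 continuousAt_const
    · have hev : (fun x => φ i x * r x) =ᶠ[𝓝 x] fun _ => (0 : ℝ) := by
        filter_upwards [notMem_tsupport_iff_eventuallyEq.1 hxs] with z hz
        simp [hz]
      exact (continuousAt_congr hev).2 continuousAt_const
  -- apply the local Jacobian face to every piece
  have hpiece : ∀ i : t, ∃ I : Y → ℝ, ContinuousOn I (D (i : X)) ∧ (∀ W, 0 ≤ I W) ∧
      ∀ A : Set Y, MeasurableSet A → A ⊆ D (i : X) →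
        (ν.withDensity fun x => ENNReal.ofReal (φ i x * r x)) (M ⁻¹' A) = ∫⁻ W in A, ENNReal.ofReal (I W) ∂μ :=
    fun i => hH (i : X) (htK' i) (fun x => φ i x * r x) (hmeas i) (hnn i) (hcont i) (hbdd i) (hzero i)
  choose I hIc hI0 hIA using hpiece
  -- the local density vanishes on `D i \ closure (D' i)` (§1)
  have hIvan : ∀ i : t, ∀ y ∈ D (i : X) \ closure (D' (i : X)), I i y = 0 := by
    intro i
    have hUo : IsOpen (D (i : X) \ closure (D' (i : X))) := (hD _ (htK' i)).sdiff isClosed_closure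
    refine eqOn_zero_of_setLIntegral_eq_zero μ hUo ((hIc i).mono sdiff_subset) (fun y _ => hI0 i y) ?_
    rw [← hIA i _ hUo.measurableSet sdiff_subset, withDensity_apply _ (hM hUo.measurableSet)]
    have hz : EqOn (fun x => ENNReal.ofReal (φ i x * r x)) (fun _ => 0)
        (M ⁻¹' (D (i : X) \ closure (D' (i : X)))) := by
      intro x hx
      have hφ0 : φ i x = 0 := by
        by_contra h
        exact hx.2 (subset_closure (hφD' i x h))
      simp [hφ0]
    rw [setLIntegral_congr_fun (hM hUo.measurableSet) hz, lintegral_zero]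
  -- extension by zero off `D i` is continuous on all of `Y`
  have hIt_cont : ∀ i : t, Continuous ((D (i : X)).indicator (I i)) := by
    intro i
    refine continuous_iff_continuousAt.2 fun y => ?_
    by_cases hy : y ∈ D (i : X)
    · have h1 : (D (i : X)).indicator (I i) =ᶠ[𝓝 y] I i := by
        filter_upwards [(hD _ (htK' i)).mem_nhds hy] with z hz using indicator_of_mem hz _
      exact (continuousAt_congr h1).2 ((hIc i).continuousAt ((hD _ (htK' i)).mem_nhds hy))
    · have hy' : y ∉ closure (D' (i : X)) := fun h => hy (hD'c _ (htK' i) h)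
      have h1 : (D (i : X)).indicator (I i) =ᶠ[𝓝 y] fun _ => (0 : ℝ) := by
        filter_upwards [isClosed_closure.isOpen_compl.mem_nhds hy'] with z hz
        by_cases hz' : z ∈ D (i : X)
        · rw [indicator_of_mem hz']
          exact hIvan i z ⟨hz', hz⟩
        · exact indicator_of_notMem hz' _
      exact (continuousAt_congr h1).2 continuousAt_const
  have hIt_nn : ∀ i : t, ∀ W, 0 ≤ (D (i : X)).indicator (I i) W :=
    fun i W => indicator_nonneg (fun W _ => hI0 i W) W
  -- the identity for every piece and EVERY measurable `A`
  have hIt_A : ∀ i : t, ∀ A : Set Y, MeasurableSet A →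
      (ν.withDensity fun x => ENNReal.ofReal (φ i x * r x)) (M ⁻¹' A) =
        ∫⁻ W in A, ENNReal.ofReal ((D (i : X)).indicator (I i) W) ∂μ := by
    intro i A hA
    have hDm : MeasurableSet (D (i : X)) := (hD _ (htK' i)).measurableSet
    rw [← measure_inter_add_sdiff (M ⁻¹' A) (hM hDm), ← lintegral_inter_add_sdiff _ A hDm, ← preimage_inter,
      ← preimage_sdiff]
    congr 1
    · rw [hIA i _ (hA.inter hDm) inter_subset_right]
      exact setLIntegral_congr_fun (hA.inter hDm) fun W hW => by rw [indicator_of_mem hW.2]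
    · rw [withDensity_apply _ (hM (hA.diff hDm))]
      have h1 : EqOn (fun x => ENNReal.ofReal (φ i x * r x)) (fun _ => 0) (M ⁻¹' (A \ D (i : X))) := by
        intro x hx
        have hφ0 : φ i x = 0 := by
          by_contra h
          exact hx.2 (hD'D _ (htK' i) (hφD' i x h))
        simp [hφ0]
      have h2 : EqOn (fun W => ENNReal.ofReal ((D (i : X)).indicator (I i) W)) (fun _ => 0) (A \ D (i : X)) := by
        intro W hW
        simp [indicator_of_notMem hW.2]
      rw [setLIntegral_congr_fun (hM (hA.diff hDm)) h1, setLIntegral_congr_fun (hA.diff hDm) h2, lintegral_zero,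
        lintegral_zero]
  -- `r = Σ_i φ i · r` pointwise (on `K` the `φ i` sum to one, off `K` both sides vanish)
  have hsum : ∀ x, ENNReal.ofReal (r x) = ∑ i : t, ENNReal.ofReal (φ i x * r x) := by
    intro x
    rw [← ENNReal.ofReal_sum_of_nonneg (fun i _ => hnn i x)]
    congr 1
    by_cases hx : x ∈ K
    · rw [← Finset.sum_mul, ← finsum_eq_sum_of_fintype, φ.sum_eq_one hx, one_mul]
    · simp [hrK x hx]
  -- glue
  refine ⟨fun W => ∑ i : t, (D (i : X)).indicator (I i) W, continuous_finsetSum _ fun i _ => hIt_cont i,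
    fun W => Finset.sum_nonneg fun i _ => hIt_nn i W, fun A hA => ?_⟩
  calc (ν.withDensity fun x => ENNReal.ofReal (r x)) (M ⁻¹' A)
      = ∫⁻ x in M ⁻¹' A, ENNReal.ofReal (r x) ∂ν := withDensity_apply _ (hM hA)
    _ = ∫⁻ x in M ⁻¹' A, ∑ i : t, ENNReal.ofReal (φ i x * r x) ∂ν := lintegral_congr fun x => hsum x
    _ = ∑ i : t, ∫⁻ x in M ⁻¹' A, ENNReal.ofReal (φ i x * r x) ∂ν :=
        lintegral_finsetSum _ fun i _ => (hmeas i).ennreal_ofReal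
    _ = ∑ i : t, (ν.withDensity fun x => ENNReal.ofReal (φ i x * r x)) (M ⁻¹' A) :=
        Finset.sum_congr rfl fun i _ => (withDensity_apply _ (hM hA)).symm
    _ = ∑ i : t, ∫⁻ W in A, ENNReal.ofReal ((D (i : X)).indicator (I i) W) ∂μ :=
        Finset.sum_congr rfl fun i _ => hIt_A i A hA
    _ = ∫⁻ W in A, ∑ i : t, ENNReal.ofReal ((D (i : X)).indicator (I i) W) ∂μ :=
        (lintegral_finsetSum _ fun i _ => (hIt_cont i).measurable.ennreal_ofReal).symm
    _ = ∫⁻ W in A, ENNReal.ofReal (∑ i : t, (D (i : X)).indicator (I i) W) ∂μ :=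
        lintegral_congr fun W => (ENNReal.ofReal_sum_of_nonneg fun i _ => hIt_nn i W).symm

/-- ★★★ **PUSH-FORWARD DENSITIES: CONTINUITY IS LOCAL ON THE SOURCE (engine form).**  As
`exists_continuous_density_of_locally'`, with the local face asked only of densities continuous INSIDE the window: at every
`a ∈ K`, `M` is continuous at `a` and there are open `O ∋ a`,
`D ∋ M a` such that every measurable bounded `r′ ≥ 0` vanishing off `O` and continuous at each `x ∈ O` with `Q x` has above `D` a
density of `M_*(r′·ν)` continuous on `D` — VERBATIM the conclusion shape of the local engines
`SubmersionPushforward.exists_continuousOn_density_map_of_submersion` (`Q ≡ True`) and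
`AnalyticSubmersion.exists_continuousOn_density_map_of_analytic_submersion_sharp` (`Q x := g x ≠ 0`).  THEN every measurable
bounded `r ≥ 0` vanishing off the compact `K` and continuous at each `x ∈ K` with `Q x` has a push-forward density `I ≥ 0`
CONTINUOUS ON ALL OF `Y`, `(r·ν)(M⁻¹A) = ∫⁻_A I dμ` for every measurable `A`.
[cite: HormanderALPDO1, §6.1, proof of Thm 6.1.2 (push-forward under a submersion, «by a partition of unity»)] -/
theorem exists_continuous_density_of_locally (ν : Measure X) (μ : Measure Y) [μ.IsOpenPosMeasure]
    {M : X → Y} (hM : Measurable M) (Q : X → Prop) {K : Set X} (hK : IsCompact K)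
    (hloc : ∀ a ∈ K, ∃ O : Set X, ∃ D : Set Y, ContinuousAt M a ∧ IsOpen O ∧ a ∈ O ∧ IsOpen D ∧ M a ∈ D ∧
      ∀ r : X → ℝ, Measurable r → (∀ x, 0 ≤ r x) → (∀ x ∈ O, Q x → ContinuousAt r x) →
        (∃ C : ℝ, ∀ x, r x ≤ C) → (∀ x, x ∉ O → r x = 0) →
        ∃ I : Y → ℝ, ContinuousOn I D ∧ (∀ W, 0 ≤ I W) ∧ ∀ A : Set Y, MeasurableSet A → A ⊆ D →
          (ν.withDensity fun x => ENNReal.ofReal (r x)) (M ⁻¹' A) = ∫⁻ W in A, ENNReal.ofReal (I W) ∂μ)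
    (r : X → ℝ) (hrm : Measurable r) (hr0 : ∀ x, 0 ≤ r x) (hrc : ∀ x ∈ K, Q x → ContinuousAt r x)
    (hrC : ∃ C : ℝ, ∀ x, r x ≤ C) (hrK : ∀ x, x ∉ K → r x = 0) :
    ∃ I : Y → ℝ, Continuous I ∧ (∀ W, 0 ≤ I W) ∧ ∀ A : Set Y, MeasurableSet A →
      (ν.withDensity fun x => ENNReal.ofReal (r x)) (M ⁻¹' A) = ∫⁻ W in A, ENNReal.ofReal (I W) ∂μ := by
  refine exists_continuous_density_of_locally' ν μ hM Q hK (fun a ha => ?_) r hrm hr0 hrc hrC hrK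
  obtain ⟨O, D, hMc, hO, haO, hD, haD, hH⟩ := hloc a ha
  exact ⟨O, D, hMc, hO, haO, hD, haD, fun r' h1 h2 h3 h4 h5 =>
    hH r' h1 h2 (fun x _ hQ => h3 x fun _ => hQ) h4 h5⟩

/-- **Compact source.**  On a compact T₂ source the support condition disappears: if the local Jacobian face (one-window form)
holds at EVERY point of `X`, every measurable bounded `r ≥ 0` continuous at each `x` with `Q x` has a push-forward density
continuous on all of `Y`.  (The record's species: `X = SU(N)^{B_f}` with product Haar measure.)
[cite: HormanderALPDO1, §6.1, proof of Thm 6.1.2 (push-forward under a submersion, «by a partition of unity»)] -/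
theorem exists_continuous_density_of_locally_of_compactSpace [CompactSpace X] (ν : Measure X) (μ : Measure Y)
    [μ.IsOpenPosMeasure] {M : X → Y} (hM : Measurable M) (Q : X → Prop)
    (hloc : ∀ a : X, ∃ O : Set X, ∃ D : Set Y, ContinuousAt M a ∧ IsOpen O ∧ a ∈ O ∧ IsOpen D ∧ M a ∈ D ∧
      ∀ r : X → ℝ, Measurable r → (∀ x, 0 ≤ r x) → (∀ x ∈ O, Q x → ContinuousAt r x) →
        (∃ C : ℝ, ∀ x, r x ≤ C) → (∀ x, x ∉ O → r x = 0) →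
        ∃ I : Y → ℝ, ContinuousOn I D ∧ (∀ W, 0 ≤ I W) ∧ ∀ A : Set Y, MeasurableSet A → A ⊆ D →
          (ν.withDensity fun x => ENNReal.ofReal (r x)) (M ⁻¹' A) = ∫⁻ W in A, ENNReal.ofReal (I W) ∂μ)
    (r : X → ℝ) (hrm : Measurable r) (hr0 : ∀ x, 0 ≤ r x) (hrc : ∀ x, Q x → ContinuousAt r x)
    (hrC : ∃ C : ℝ, ∀ x, r x ≤ C) :
    ∃ I : Y → ℝ, Continuous I ∧ (∀ W, 0 ≤ I W) ∧ ∀ A : Set Y, MeasurableSet A →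
      (ν.withDensity fun x => ENNReal.ofReal (r x)) (M ⁻¹' A) = ∫⁻ W in A, ENNReal.ofReal (I W) ∂μ :=
  exists_continuous_density_of_locally ν μ hM Q isCompact_univ (fun a _ => hloc a) r hrm hr0 (fun x _ => hrc x) hrC
    fun x hx => (hx (mem_univ x)).elim

end Gluing

/-! ## §3 Forms for consumers: measure identity and the test-function identities -/

section Forms

variable {X : Type*} [MeasurableSpace X] {Y : Type*} [MeasurableSpace Y]

/-- The set identity `(ρ·ν)(M⁻¹A) = ∫⁻_A I dμ` for every measurable `A` IS the equality of measures `(ρ·ν).map M = I·μ`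
(the push-forward `f_*u : φ ↦ u(φ ∘ f)` of a density, read on sets; bookkeeping).
[cite: HormanderALPDO1, §6.1 (push-forward of a density under a map; bookkeeping)] -/
theorem map_withDensity_eq_withDensity_of_forall_preimage (ν : Measure X) (μ : Measure Y) {M : X → Y}
    (hM : Measurable M) {ρ : X → ℝ≥0∞} {I : Y → ℝ≥0∞}
    (h : ∀ A : Set Y, MeasurableSet A → (ν.withDensity ρ) (M ⁻¹' A) = ∫⁻ W in A, I W ∂μ) :
    (ν.withDensity ρ).map M = μ.withDensity I := by
  ext A hA
  rw [map_apply hM hA, h A hA, withDensity_apply _ hA]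

/-- Window version: the identity for the measurable `A ⊆ D` (the local engines' conclusion shape) IS the equality of the
two measures restricted to `D` (bookkeeping). [cite: HormanderALPDO1, §6.1 (push-forward of a density under a map; bookkeeping)] -/
theorem restrict_map_withDensity_eq_of_forall_preimage (ν : Measure X) (μ : Measure Y) {M : X → Y}
    (hM : Measurable M) {ρ : X → ℝ≥0∞} {I : Y → ℝ≥0∞} {D : Set Y} (hD : MeasurableSet D)
    (h : ∀ A : Set Y, MeasurableSet A → A ⊆ D → (ν.withDensity ρ) (M ⁻¹' A) = ∫⁻ W in A, I W ∂μ) :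
    ((ν.withDensity ρ).map M).restrict D = (μ.withDensity I).restrict D := by
  ext A hA
  rw [restrict_apply hA, restrict_apply hA, map_apply hM (hA.inter hD), h _ (hA.inter hD) inter_subset_right,
    withDensity_apply _ (hA.inter hD)]

/-- Lower-integral test form of the set identity: `∫⁻ f(M x) ρ(x) dν = ∫⁻ f(W) I(W) dμ` for every measurable
`f : Y → ℝ≥0∞` — the defining identity `∫ (Tρ)(V) f(V) dV = ∫ ρ(U) f(Ū) dU` of a push-forward density (bookkeeping).
[cite: Balaban1987RG1, (0.13) p.254 (the push-forward identity; bookkeeping)] -/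
theorem lintegral_comp_mul_eq_of_forall_preimage (ν : Measure X) (μ : Measure Y) {M : X → Y} (hM : Measurable M)
    {ρ : X → ℝ≥0∞} (hρ : Measurable ρ) {I : Y → ℝ≥0∞} (hI : Measurable I)
    (h : ∀ A : Set Y, MeasurableSet A → (ν.withDensity ρ) (M ⁻¹' A) = ∫⁻ W in A, I W ∂μ)
    {f : Y → ℝ≥0∞} (hf : Measurable f) :
    ∫⁻ x, f (M x) * ρ x ∂ν = ∫⁻ W, f W * I W ∂μ := by
  have hmap := map_withDensity_eq_withDensity_of_forall_preimage ν μ hM h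
  calc ∫⁻ x, f (M x) * ρ x ∂ν = ∫⁻ x, (ρ * fun x => f (M x)) x ∂ν := lintegral_congr fun x => by simp [mul_comm]
    _ = ∫⁻ x, f (M x) ∂(ν.withDensity ρ) := (lintegral_withDensity_eq_lintegral_mul _ hρ (hf.comp hM)).symm
    _ = ∫⁻ W, f W ∂((ν.withDensity ρ).map M) := (lintegral_map hf hM).symm
    _ = ∫⁻ W, f W ∂(μ.withDensity I) := by rw [hmap]
    _ = ∫⁻ W, (I * f) W ∂μ := lintegral_withDensity_eq_lintegral_mul _ hI hf
    _ = ∫⁻ W, f W * I W ∂μ := lintegral_congr fun W => by simp [mul_comm]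

/-- ★ **The test-function identity** `∫ r x * f (M x) dν = ∫ I W * f W dμ` for EVERY measurable real test `f` — the hypothesis
shape `h` of `Node00.RegSetOfFibredChart.subset_regSetOfRecord_of_forall_integral_eq` ∕ `hasContTransportOn_of_forall_integral_eq`
(with their `ρ := r`, `g := I`).  No integrability is needed: by `integral_withDensity_eq_integral_smul` and `integral_map` both
sides are the Bochner integral of `f` against the same measure `(r·ν).map M = I·μ`.
[cite: Balaban1987RG1, (0.13) p.254 (the push-forward identity `∫ (Tρ)(V) f(V) dV = ∫ ρ(U) f(Ū) dU`; bookkeeping)] -/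
theorem integral_mul_comp_eq_integral_mul_of_forall_preimage (ν : Measure X) (μ : Measure Y) {M : X → Y}
    (hM : Measurable M) {r : X → ℝ} (hrm : Measurable r) (hr0 : ∀ x, 0 ≤ r x) {I : Y → ℝ} (hIm : Measurable I)
    (hI0 : ∀ W, 0 ≤ I W)
    (h : ∀ A : Set Y, MeasurableSet A →
      (ν.withDensity fun x => ENNReal.ofReal (r x)) (M ⁻¹' A) = ∫⁻ W in A, ENNReal.ofReal (I W) ∂μ)
    {f : Y → ℝ} (hf : Measurable f) :
    ∫ x, r x * f (M x) ∂ν = ∫ W, I W * f W ∂μ := by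
  have hmap := map_withDensity_eq_withDensity_of_forall_preimage ν μ hM h
  have e1 : (fun x => ENNReal.ofReal (r x)) = fun x => ((Real.toNNReal (r x) : ℝ≥0) : ℝ≥0∞) := rfl
  have e2 : (fun W => ENNReal.ofReal (I W)) = fun W => ((Real.toNNReal (I W) : ℝ≥0) : ℝ≥0∞) := rfl
  calc ∫ x, r x * f (M x) ∂ν = ∫ x, Real.toNNReal (r x) • f (M x) ∂ν := by
        refine integral_congr_ae (Eventually.of_forall fun x => ?_)
        simp [NNReal.smul_def, Real.coe_toNNReal _ (hr0 x)]
    _ = ∫ x, f (M x) ∂(ν.withDensity fun x => ENNReal.ofReal (r x)) := by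
        rw [e1, integral_withDensity_eq_integral_smul hrm.real_toNNReal]
    _ = ∫ W, f W ∂((ν.withDensity fun x => ENNReal.ofReal (r x)).map M) :=
        (integral_map hM.aemeasurable hf.aestronglyMeasurable).symm
    _ = ∫ W, f W ∂(μ.withDensity fun W => ENNReal.ofReal (I W)) := by rw [hmap]
    _ = ∫ W, Real.toNNReal (I W) • f W ∂μ := by
        rw [e2, integral_withDensity_eq_integral_smul hIm.real_toNNReal]
    _ = ∫ W, I W * f W ∂μ := by
        refine integral_congr_ae (Eventually.of_forall fun W => ?_)
        simp [NNReal.smul_def, Real.coe_toNNReal _ (hI0 W)]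

/-- Window version of the test-function identity: from the identity for the measurable `A ⊆ D` (a local engine's conclusion),
`∫ r x * f (M x) dν = ∫ I W * f W dμ` for every measurable real test `f` VANISHING OFF `D` — the door's hypothesis with `U := D`.
[cite: Balaban1987RG1, (0.13) p.254 (the push-forward identity, tests supported in a window; bookkeeping)] -/
theorem integral_mul_comp_eq_integral_mul_of_forall_preimage_subset (ν : Measure X) (μ : Measure Y) {M : X → Y}
    (hM : Measurable M) {r : X → ℝ} (hrm : Measurable r) (hr0 : ∀ x, 0 ≤ r x) {I : Y → ℝ} (hIm : Measurable I)
    (hI0 : ∀ W, 0 ≤ I W) {D : Set Y} (hD : MeasurableSet D)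
    (h : ∀ A : Set Y, MeasurableSet A → A ⊆ D →
      (ν.withDensity fun x => ENNReal.ofReal (r x)) (M ⁻¹' A) = ∫⁻ W in A, ENNReal.ofReal (I W) ∂μ)
    {f : Y → ℝ} (hf : Measurable f) (hfD : ∀ W, W ∉ D → f W = 0) :
    ∫ x, r x * f (M x) ∂ν = ∫ W, I W * f W ∂μ := by
  -- replace `I` by its restriction to `D`: the identity then holds for every measurable `A`
  have h' : ∀ A : Set Y, MeasurableSet A →
      (ν.withDensity fun x => ENNReal.ofReal (r x * (D.indicator (fun _ => (1 : ℝ)) (M x)))) (M ⁻¹' A) =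
        ∫⁻ W in A, ENNReal.ofReal (D.indicator I W) ∂μ := by
    intro A hA
    rw [withDensity_apply _ (hM hA), ← lintegral_inter_add_sdiff _ (M ⁻¹' A) (hM hD),
      ← lintegral_inter_add_sdiff _ A hD, ← preimage_inter, ← preimage_sdiff]
    congr 1
    · calc ∫⁻ x in M ⁻¹' (A ∩ D), ENNReal.ofReal (r x * D.indicator (fun _ => (1 : ℝ)) (M x)) ∂ν
          = ∫⁻ x in M ⁻¹' (A ∩ D), ENNReal.ofReal (r x) ∂ν :=
            setLIntegral_congr_fun (hM (hA.inter hD)) fun x hx => by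
              simp [indicator_of_mem (show M x ∈ D from hx.2)]
        _ = (ν.withDensity fun x => ENNReal.ofReal (r x)) (M ⁻¹' (A ∩ D)) :=
            (withDensity_apply _ (hM (hA.inter hD))).symm
        _ = ∫⁻ W in A ∩ D, ENNReal.ofReal (I W) ∂μ := h _ (hA.inter hD) inter_subset_right
        _ = ∫⁻ W in A ∩ D, ENNReal.ofReal (D.indicator I W) ∂μ :=
            setLIntegral_congr_fun (hA.inter hD) fun W hW => by simp [indicator_of_mem hW.2]
    · have h1: EqOn (fun x => ENNReal.ofReal (r x * D.indicator (fun _ => (1 : ℝ)) (M x))) (fun _ => 0)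
          (M ⁻¹' (A \ D)) := fun x hx => by simp [indicator_of_notMem (show M x ∉ D from hx.2)]
      have h2 : EqOn (fun W => ENNReal.ofReal (D.indicator I W)) (fun _ => 0) (A \ D) := fun W hW => by
        simp [indicator_of_notMem hW.2]
      rw [setLIntegral_congr_fun (hM (hA.diff hD)) h1, setLIntegral_congr_fun (hA.diff hD) h2, lintegral_zero,
        lintegral_zero]
  have key := integral_mul_comp_eq_integral_mul_of_forall_preimage ν μ hM
    (hrm.mul ((measurable_const.indicator hD).comp hM)) (fun x => mul_nonneg (hr0 x)
      (indicator_nonneg (fun _ _ => zero_le_one) _)) (hIm.indicator hD) (fun W => indicator_nonneg (fun W _ => hI0 W) W)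
    h' hf
  have l1 : ∀ x, r x * D.indicator (fun _ => (1 : ℝ)) (M x) * f (M x) = r x * f (M x) := by
    intro x
    by_cases hx : M x ∈ D
    · simp [indicator_of_mem hx]
    · simp [hfD _ hx]
  have l2 : ∀ W, D.indicator I W * f W = I W * f W := by
    intro W
    by_cases hW : W ∈ D
    · simp [indicator_of_mem hW]
    · simp [hfD _ hW]
  simpa [l1, l2] using key

end Forms

end Literature.MeasureTheory.Integral.PushforwardDensityGluing

end
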